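import Summits.QuantumFields.YangMills.Theorems.FluctuationComparisonRegPrIntLS2BetaOneStepLocalAxialBounds
import HarnessLib

/-!
# GAP♯∘'s KINEMATICS IN LOCAL FORM, II — the face transfer, the sweep and every crossing link with plaquette letters LOCAL to the block
# (crux `FluctuationComparisonRegPrIntL`, stmt-QuantumFields-20520; registry v11.4 `Cruxes/FluctuationComparisonRegPrIntL/Lines/semiclassical_s2beta.lean` 3732b7df FROZEN, untouched)

Cell `ym3-torus` (YM ladder rung R3 = continuum `SU(2)` Yang–Mills on the three-torus — a RUNG: NOT d = 4, NOT infinite volume, NOT a mass gap, NOT Clay).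
Width seat `ym3-torus-px12` (gen 22); `--kind proof --supports stmt-QuantumFields-20520 --as helper`, count-neutral, DEFINITION-FREE (0 `def`, 0 `instance`,
0 `notation`, 0 `sorry`, default heartbeats).  Companion of `…S2BetaOneStepLocalAxialBounds` (§1 locality, §2 interior bonds, §3 central crossing link — local letters).

WHAT (one block level on the finest lattice of a torus `P`, pair `W, Y` with the SAME comb transporters from the centre of every `1`-block; the plaquette letter is asked
ONLY of the plaquettes based within torus distance `2dL + L` of the block centre `emb y`).
* §4 ★ `dist1_cross_shift_le_local` ∕ `dist1_cross_le_shift_local` — px8 g18's face transfer (✓`…InterBlockFace.dist1_transfer_fwd∕bwd` BY NAME) with the LOCAL interior bound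
  (`dist1_mul_inv_le_interior_local`) and the LOCAL swap defect (✓`LatticeWordStokesLocal.dist1_swapDefect_le_local`) in place of the global letters;
  ★ `dist1_cross_le_sweep_local` — px8 g18's sweep over the face (✓`…InterBlock.dist1_cross_le_sweep`'s induction verbatim over the local transfer).
* §5 ★★ `dist1_cross_le_local` — EVERY crossing link of the face `(y, μ)` (`SU(N)`, `ℰ = expMeanLogSU`): `≤ α₁ + 12·(((d+2)L)²∕4)·a + d·h·(4(dL)² + 2)·a`, all letters local to `y`
  — the local edition of INTER₀∘ (✓`…InterBlock.interBlock_holds`), on a general torus.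
USE: squaring and summing these per-block bounds over the torus costs a ball-multiplicity constant and NO volume factor (the volume-uniform flat-datum growth letter of the
sibling file `…S2BetaFlatTubeDepthOneUniform`).

HONEST: lattice kinematics ([Balaban1985RegularSpaces] Lemma 1 mechanism, local form; constants crude); nothing of Bałaban's analysis; TUBE-REG∘, GAP♯∘, EXW∘, S2β,
crux 20520 are NOT proved; no registered stub is closed; rung R3 = SU(2) YM₃ on T³ — NOT d = 4, NOT infinite volume, NOT a mass gap, NOT Clay; the Yang–Mills
mass gap is NOT proved.  Sorry-free, axioms standard.

References: T. Bałaban, CMP **99** (1985) 75–102 [Balaban1985RegularSpaces] ((1.19) p.79, Lemma 1 (1.24)–(1.26) pp.79–80); CMP **98** (1985) 17–51 [Balaban1985Averaging]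
((9) p.19, (19)–(20) p.21, pp.24–25); CMP **109** (1987) 249–301 [Balaban1987RG1] ((0.3)–(0.4) pp.252–253).
-/

set_option autoImplicit false

noncomputable section

namespace Summit.QuantumFields.YangMills.Theorems.FluctuationComparisonRegPrIntLS2BetaOneStepLocalCrossingBounds

open Literature.MathematicalPhysics.QuantumFieldTheory.Balaban1983to89
open T4Continuum T4ReflectionCone BlockAveraging AveragingRT ExpMeanLog
open B7Prop1Explicit (e e_apply l1 treeWord)
open B10Eq27TorusAxialLog (holT axialT rel transl transl_add_e)
open B10StarCount (blockOf_shift)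
open B5Eq118OneStroke (iterBlockOf)
open B15DeterminingSets (embIter)
open B3Taylor310LocalRemainder (tdist_comm tdist_self tdist_triangle)
open LatticeWordStokes (holAt_walk_tt)
open LatticeWordStokesLocal (dist1_swapDefect_le_local)
open Summit.QuantumFields.YangMills.Theorems.FluctuationComparisonRegPrIntLS2BetaInterBlockCentral (blockOf_transl_emb blockOf_axisPt blockOf_axisPt_shift)
open Summit.QuantumFields.YangMills.Theorems.FluctuationComparisonRegPrIntLS2BetaInterBlockFace (dist1_transfer_fwd dist1_transfer_bwd blockOf_shift_shift_eq exists_rel_of_cross)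
open Summit.QuantumFields.YangMills.Theorems.FluctuationComparisonRegPrIntLS2BetaInterBlock (eq_axisVec_of_l1_le exists_ne_zero_of_lt_l1 l1_add_e_succ_of_neg l1_sub_e_succ_of_pos)
open Summit.QuantumFields.YangMills.Theorems.FluctuationComparisonRegPrIntLS2BetaOneStepLocalAxialBounds

/-! ## §4 The face transfer and the sweep, LOCAL letters -/

section Sweep

variable {P : Params} {G : Type*} [GaugeGroup G]

/-- From the ball of radius `2dL + L` about `emb y` to the ball of radius `2dL` about the centre of the block of any site of `B(y)` or of `B(y)`'s
`μ`-neighbour block. (bookkeeping) [cite: Balaban1987RG1, (0.3) p.252] -/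
theorem ball_centre_of_ball (V : GaugeField P 0 G) {a : ℝ} (y : Site P 1) (μ : Fin P.d) (z : Site P 0)
    (hz : iterBlockOf 1 z = y ∨ iterBlockOf 1 z = y.shift μ)
    (hV : ∀ q : Plaq P 0, Site.tdist q.src (emb y) ≤ 2 * P.d * P.L + P.L → dist1 (GaugeField.plaqHol V q) < a) :
    ∀ q : Plaq P 0, Site.tdist q.src (embIter 1 (iterBlockOf 1 z)) ≤ 2 * P.d * P.L ^ 1 → dist1 (GaugeField.plaqHol V q) < a := by
  intro q hq
  refine hV q ((tdist_triangle q.src (embIter 1 (iterBlockOf 1 z)) (emb y)).trans ?_)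
  rw [pow_one] at hq
  have h2 : Site.tdist (embIter 1 (iterBlockOf 1 z)) (emb y) ≤ P.L := by
    rcases hz with h | h
    · rw [h]; show Site.tdist (emb y) (emb y) ≤ P.L; rw [tdist_self]; exact Nat.zero_le _
    · rw [h]; exact tdist_emb_shift_le y μ
  omega

/-- The plaquettes cornered within two steps of a site of `B(y)` lie in the ball of radius `2dL + L` about `emb y`: the local swap-defect letter at `z`.
(bookkeeping) [cite: Balaban1985Averaging, (19)-(20) p.21] -/
theorem swapDefect_le_of_ball (hk : 1 ≤ P.m + P.K) (V : GaugeField P 0 G) {a : ℝ} (ha : 0 ≤ a) (y : Site P 1) (z : Site P 0)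
    (hz : iterBlockOf 1 z = y) (hV : ∀ q : Plaq P 0, Site.tdist q.src (emb y) ≤ 2 * P.d * P.L + P.L → dist1 (GaugeField.plaqHol V q) < a)
    (κ μ : Fin P.d) :
    dist1 (holAt V (walk z [(κ, true), (μ, true)]) * (holAt V (walk z [(μ, true), (κ, true)]))⁻¹) ≤ a := by
  refine dist1_swapDefect_le_local V ha z (κ, true) (μ, true) fun u hu a' b' hab => hV _ ?_
  have h1 : Site.tdist (walkEnd z u) z ≤ 2 := (tdist_walkEnd_le z u).trans (length_le_of_count_le hu)
  have h2 : Site.tdist z (emb y) ≤ P.d * P.L := by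
    have h := tdist_centre_le (k := 1) hk z
    rwa [pow_one, hz] at h
  have hL : 2 ≤ P.L := P.hL.2
  have h3 : 2 * P.d * P.L = 2 * (P.d * P.L) := by ring
  show Site.tdist (walkEnd z u) (emb y) ≤ 2 * P.d * P.L + P.L
  calc Site.tdist (walkEnd z u) (emb y) ≤ Site.tdist (walkEnd z u) z + Site.tdist z (emb y) := tdist_triangle _ _ _
    _ ≤ 2 + P.d * P.L := add_le_add h1 h2
    _ ≤ 2 * P.d * P.L + P.L := by omega

/-- ★ **THE FACE TRANSFER, FORWARD, LOCAL LETTERS** — px8 g18's ✓`…InterBlockFace.dist1_cross_shift_le` with the interior bounds from §2 and the local swap defect: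
`W`, `Y` with the same `1`-block comb transporters, plaquettes within torus distance `2dL + L` of `emb y` within `a ≥ 0` of `1`, `z ∈ B(y)`, `κ ≠ μ`, `z + e_κ ∈ B(y)` ⟹
`dist1(W⟨z+e_κ,μ⟩·Y⟨z+e_κ,μ⟩⁻¹) ≤ dist1(W⟨z,μ⟩·Y⟨z,μ⟩⁻¹) + (4(dL)² + 2)·a`. [cite: Balaban1985RegularSpaces, Lemma 1 (1.25) p.79; Balaban1985Averaging, (19)-(20) p.21, pp.24-25] -/
theorem dist1_cross_shift_le_local (hk : 1 ≤ P.m + P.K) (W Y : GaugeField P 0 G) {a : ℝ} (ha : 0 ≤ a)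
    (hax : ∀ x : Site P 0, axialT W (embIter 1 (iterBlockOf 1 x)) x = axialT Y (embIter 1 (iterBlockOf 1 x)) x)
    (y : Site P 1) (z : Site P 0) (hz : iterBlockOf 1 z = y) {μ κ : Fin P.d} (hκμ : κ ≠ μ) (hin : iterBlockOf 1 (z.shift κ) = iterBlockOf 1 z)
    (hW : ∀ q : Plaq P 0, Site.tdist q.src (emb y) ≤ 2 * P.d * P.L + P.L → dist1 (GaugeField.plaqHol W q) < a)
    (hY : ∀ q : Plaq P 0, Site.tdist q.src (emb y) ≤ 2 * P.d * P.L + P.L → dist1 (GaugeField.plaqHol Y q) < a) :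
    dist1 (W ⟨z.shift κ, μ⟩ * (Y ⟨z.shift κ, μ⟩)⁻¹) ≤
      dist1 (W ⟨z, μ⟩ * (Y ⟨z, μ⟩)⁻¹) + (4 * ((P.d : ℝ) * (P.L : ℝ)) ^ 2 + 2) * a := by
  have hj : 0 + 1 ≤ P.m + P.K := hk
  have hin' : iterBlockOf 1 ((z.shift μ).shift κ) = iterBlockOf 1 (z.shift μ) := blockOf_shift_shift_eq z hκμ hin
  have hzμ : iterBlockOf 1 (z.shift μ) = y ∨ iterBlockOf 1 (z.shift μ) = y.shift μ := by
    show blockOf (z.shift μ) = y ∨ blockOf (z.shift μ) = y.shift μ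
    rw [blockOf_shift hj z μ]
    have hz' : blockOf z = y := hz
    split_ifs
    · exact Or.inr (by rw [hz'])
    · exact Or.inl hz'
  have h1 := dist1_mul_inv_le_interior_local (k := 1) hk W Y ha ha hax z κ hin
    (ball_centre_of_ball W y μ z (Or.inl hz) hW) (ball_centre_of_ball Y y μ z (Or.inl hz) hY)
  have h2 := dist1_mul_inv_le_interior_local (k := 1) hk W Y ha ha hax (z.shift μ) κ hin'
    (ball_centre_of_ball W y μ (z.shift μ) hzμ hW) (ball_centre_of_ball Y y μ (z.shift μ) hzμ hY)
  have hPW := swapDefect_le_of_ball hk W ha y z hz hW κ μ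
  have hPY := swapDefect_le_of_ball hk Y ha y z hz hY κ μ
  rw [holAt_walk_tt, holAt_walk_tt] at hPW hPY
  have halg := dist1_transfer_fwd (W ⟨z, κ⟩) (Y ⟨z, κ⟩) (W ⟨z.shift μ, κ⟩) (Y ⟨z.shift μ, κ⟩) (W ⟨z, μ⟩) (Y ⟨z, μ⟩)
    (W ⟨z.shift κ, μ⟩) (Y ⟨z.shift κ, μ⟩)
  rw [pow_one] at h1 h2
  nlinarith [GaugeGroup.dist1_nonneg (W ⟨z, κ⟩ * (Y ⟨z, κ⟩)⁻¹)]

/-- ★ **THE FACE TRANSFER, BACKWARD, LOCAL LETTERS** (px8 g18's ✓`dist1_cross_le_shift`, local edition). [cite: Balaban1985RegularSpaces, Lemma 1 (1.25) p.79; Balaban1985Averaging, (19)-(20) p.21] -/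
theorem dist1_cross_le_shift_local (hk : 1 ≤ P.m + P.K) (W Y : GaugeField P 0 G) {a : ℝ} (ha : 0 ≤ a)
    (hax : ∀ x : Site P 0, axialT W (embIter 1 (iterBlockOf 1 x)) x = axialT Y (embIter 1 (iterBlockOf 1 x)) x)
    (y : Site P 1) (z : Site P 0) (hz : iterBlockOf 1 z = y) {μ κ : Fin P.d} (hκμ : κ ≠ μ) (hin : iterBlockOf 1 (z.shift κ) = iterBlockOf 1 z)
    (hW : ∀ q : Plaq P 0, Site.tdist q.src (emb y) ≤ 2 * P.d * P.L + P.L → dist1 (GaugeField.plaqHol W q) < a)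
    (hY : ∀ q : Plaq P 0, Site.tdist q.src (emb y) ≤ 2 * P.d * P.L + P.L → dist1 (GaugeField.plaqHol Y q) < a) :
    dist1 (W ⟨z, μ⟩ * (Y ⟨z, μ⟩)⁻¹) ≤
      dist1 (W ⟨z.shift κ, μ⟩ * (Y ⟨z.shift κ, μ⟩)⁻¹) + (4 * ((P.d : ℝ) * (P.L : ℝ)) ^ 2 + 2) * a := by
  have hj : 0 + 1 ≤ P.m + P.K := hk
  have hin' : iterBlockOf 1 ((z.shift μ).shift κ) = iterBlockOf 1 (z.shift μ) := blockOf_shift_shift_eq z hκμ hin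
  have hzμ : iterBlockOf 1 (z.shift μ) = y ∨ iterBlockOf 1 (z.shift μ) = y.shift μ := by
    show blockOf (z.shift μ) = y ∨ blockOf (z.shift μ) = y.shift μ
    rw [blockOf_shift hj z μ]
    have hz' : blockOf z = y := hz
    split_ifs
    · exact Or.inr (by rw [hz'])
    · exact Or.inl hz'
  have h1 := dist1_mul_inv_le_interior_local (k := 1) hk W Y ha ha hax z κ hin
    (ball_centre_of_ball W y μ z (Or.inl hz) hW) (ball_centre_of_ball Y y μ z (Or.inl hz) hY)
  have h2 := dist1_mul_inv_le_interior_local (k := 1) hk W Y ha ha hax (z.shift μ) κ hin'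
    (ball_centre_of_ball W y μ (z.shift μ) hzμ hW) (ball_centre_of_ball Y y μ (z.shift μ) hzμ hY)
  have hPW := swapDefect_le_of_ball hk W ha y z hz hW κ μ
  have hPY := swapDefect_le_of_ball hk Y ha y z hz hY κ μ
  rw [holAt_walk_tt, holAt_walk_tt] at hPW hPY
  have halg := dist1_transfer_bwd (W ⟨z, κ⟩) (Y ⟨z, κ⟩) (W ⟨z.shift μ, κ⟩) (Y ⟨z.shift μ, κ⟩) (W ⟨z, μ⟩) (Y ⟨z, μ⟩)
    (W ⟨z.shift κ, μ⟩) (Y ⟨z.shift κ, μ⟩)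
  rw [pow_one] at h1 h2
  nlinarith [GaugeGroup.dist1_nonneg (W ⟨z, κ⟩ * (Y ⟨z, κ⟩)⁻¹)]

/-- ★ **THE SWEEP, LOCAL LETTERS** — px8 g18's ✓`…InterBlock.dist1_cross_le_sweep` over §4's transfers: on the face of `B(y)` towards `B(y + e_μ)`, every crossing link
`⟨emb y + v, μ⟩` (`|v|_∞ ≤ h`, `v_μ = h`, `|v|₁ ≤ h + n`) is within `n·(4(dL)² + 2)·a` of the central one, the plaquette letter asked only within torus distance
`2dL + L` of `emb y`. [cite: Balaban1985RegularSpaces, Lemma 1 (1.25) p.79; Balaban1985Averaging, pp.24-25] -/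
theorem dist1_cross_le_sweep_local (hk : 1 ≤ P.m + P.K) (W Y : GaugeField P 0 G) {a : ℝ} (ha : 0 ≤ a)
    (hax : ∀ x : Site P 0, axialT W (embIter 1 (iterBlockOf 1 x)) x = axialT Y (embIter 1 (iterBlockOf 1 x)) x)
    (y : Site P 1) (μ : Fin P.d)
    (hW : ∀ q : Plaq P 0, Site.tdist q.src (emb y) ≤ 2 * P.d * P.L + P.L → dist1 (GaugeField.plaqHol W q) < a)
    (hY : ∀ q : Plaq P 0, Site.tdist q.src (emb y) ≤ 2 * P.d * P.L + P.L → dist1 (GaugeField.plaqHol Y q) < a) :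
    ∀ (n : ℕ) (v : B7Prop1Explicit.Site P.d), (∀ ν, (v ν).natAbs ≤ (P.L - 1) / 2) → v μ = (((P.L - 1) / 2 : ℕ) : ℤ) →
      l1 v ≤ (P.L - 1) / 2 + n →
      dist1 (W ⟨transl (emb y) v, μ⟩ * (Y ⟨transl (emb y) v, μ⟩)⁻¹) ≤
        dist1 (W ⟨transl (emb y) ((((P.L - 1) / 2 : ℕ) : ℤ) • e μ), μ⟩ *
            (Y ⟨transl (emb y) ((((P.L - 1) / 2 : ℕ) : ℤ) • e μ), μ⟩)⁻¹) +
          (n : ℝ) * ((4 * ((P.d : ℝ) * (P.L : ℝ)) ^ 2 + 2) * a)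
  | 0, v, hv, hvμ, hl => by
    rw [eq_axisVec_of_l1_le hvμ (by simpa using hl), Nat.cast_zero, zero_mul, add_zero]
  | n + 1, v, hv, hvμ, hl => by
    have hj : 0 + 1 ≤ P.m + P.K := hk
    have hs : 0 ≤ (4 * ((P.d : ℝ) * (P.L : ℝ)) ^ 2 + 2) * a := by positivity
    have hcast : (((n + 1 : ℕ)) : ℝ) = (n : ℝ) + 1 := by push_cast; ring
    rw [hcast]
    by_cases hle : l1 v ≤ (P.L - 1) / 2 + n
    · have ih := dist1_cross_le_sweep_local hk W Y ha hax y μ hW hY n v hv hvμ hle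
      nlinarith
    · obtain ⟨κ, hκμ, hκ⟩ := exists_ne_zero_of_lt_l1 hvμ (by omega)
      rcases lt_or_gt_of_ne hκ with hneg | hpos
      · have hv' : ∀ ν, ((v + e κ) ν).natAbs ≤ (P.L - 1) / 2 := fun ν => by
          rw [Pi.add_apply, e_apply]
          by_cases hν : ν = κ
          · subst hν; rw [if_pos rfl]
            have h1 := hv ν
            rcases Int.natAbs_eq (v ν) with hh | hh <;> rcases Int.natAbs_eq (v ν + 1) with hh' | hh' <;> omega
          · rw [if_neg hν, add_zero]; exact hv ν
        have hv'μ : (v + e κ) μ = (((P.L - 1) / 2 : ℕ) : ℤ) := by rw [Pi.add_apply, e_apply, if_neg (Ne.symm hκμ), add_zero, hvμ]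
        have hl' : l1 (v + e κ) ≤ (P.L - 1) / 2 + n := by have := l1_add_e_succ_of_neg hneg; omega
        have ih := dist1_cross_le_sweep_local hk W Y ha hax y μ hW hY n (v + e κ) hv' hv'μ hl'
        have hzB : iterBlockOf 1 (transl (emb y) v) = y := blockOf_transl_emb hj y hv
        have hin : iterBlockOf 1 ((transl (emb y) v).shift κ) = iterBlockOf 1 (transl (emb y) v) := by
          show blockOf ((transl (emb y) v).shift κ) = blockOf (transl (emb y) v)
          rw [← transl_add_e, blockOf_transl_emb hj y hv', blockOf_transl_emb hj y hv]
        have hstep := dist1_cross_le_shift_local hk W Y ha hax y (transl (emb y) v) hzB hκμ hin hW hY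
        rw [← transl_add_e] at hstep
        linarith
      · have hv' : ∀ ν, ((v - e κ) ν).natAbs ≤ (P.L - 1) / 2 := fun ν => by
          rw [Pi.sub_apply, e_apply]
          by_cases hν : ν = κ
          · subst hν; rw [if_pos rfl]
            have h1 := hv ν
            rcases Int.natAbs_eq (v ν) with hh | hh <;> rcases Int.natAbs_eq (v ν - 1) with hh' | hh' <;> omega
          · rw [if_neg hν, sub_zero]; exact hv ν
        have hv'μ : (v - e κ) μ = (((P.L - 1) / 2 : ℕ) : ℤ) := by rw [Pi.sub_apply, e_apply, if_neg (Ne.symm hκμ), sub_zero, hvμ]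
        have hl' : l1 (v - e κ) ≤ (P.L - 1) / 2 + n := by have := l1_sub_e_succ_of_pos hpos; omega
        have ih := dist1_cross_le_sweep_local hk W Y ha hax y μ hW hY n (v - e κ) hv' hv'μ hl'
        have hzB : iterBlockOf 1 (transl (emb y) (v - e κ)) = y := blockOf_transl_emb hj y hv'
        have hin : iterBlockOf 1 ((transl (emb y) (v - e κ)).shift κ) = iterBlockOf 1 (transl (emb y) (v - e κ)) := by
          show blockOf ((transl (emb y) (v - e κ)).shift κ) = blockOf (transl (emb y) (v - e κ))
          rw [← transl_add_e, sub_add_cancel, blockOf_transl_emb hj y hv, blockOf_transl_emb hj y hv']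
        have hstep := dist1_cross_shift_le_local hk W Y ha hax y (transl (emb y) (v - e κ)) hzB hκμ hin hW hY
        rw [← transl_add_e, sub_add_cancel] at hstep
        linarith

end Sweep

/-! ## §5 Every crossing link, LOCAL letters -/

section Cross

open scoped Matrix.Norms.L2Operator

variable {P : Params} {n : Type*} [Fintype n] [DecidableEq n] [Nonempty n]

/-- ★★ **EVERY CROSSING LINK OF A FACE, LOCAL LETTERS** — the local edition of px8 g18's INTER₀∘ (✓`…InterBlock.interBlock_holds`) on a general torus `P` and `SU(N)`:
`W`, `Y` with the same `1`-block comb transporters, a bond `⟨x, μ⟩` LEAVING the block `y = B(x)`, every plaquette based within torus distance `2dL + L` of `emb y` within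
`a ≥ 0` of `1` for both fields (`(((d+2)L)²∕4)·a < δ_N`), and the (0.4)-averages at the coarse bond `⟨y, μ⟩` within `α₁` ⟹
`dist1(W⟨x,μ⟩·Y⟨x,μ⟩⁻¹) ≤ α₁ + 12·(((d+2)L)²∕4)·a + d·h·(4(dL)² + 2)·a` (`h = (L−1)∕2`; central link §3 + sweep §4 with `n = d·h`).
[cite: Balaban1985RegularSpaces, Lemma 1 (1.24)-(1.26) pp.79-80; Balaban1985Averaging, pp.24-25; Balaban1987RG1, (0.4) p.253] -/
theorem dist1_cross_le_local (hk : 1 ≤ P.m + P.K) {a α₁ : ℝ} (ha : 0 ≤ a)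
    (W Y : GaugeField P 0 (Matrix.specialUnitaryGroup n ℂ))
    (hax : ∀ x : Site P 0, axialT W (embIter 1 (iterBlockOf 1 x)) x = axialT Y (embIter 1 (iterBlockOf 1 x)) x)
    (x : Site P 0) (μ : Fin P.d) (hcross : iterBlockOf 1 (x.shift μ) ≠ iterBlockOf 1 x)
    (hW : ∀ q : Plaq P 0, Site.tdist q.src (emb (iterBlockOf 1 x)) ≤ 2 * P.d * P.L + P.L → dist1 (GaugeField.plaqHol W q) < a)
    (hY : ∀ q : Plaq P 0, Site.tdist q.src (emb (iterBlockOf 1 x)) ≤ 2 * P.d * P.L + P.L → dist1 (GaugeField.plaqHol Y q) < a)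
    (ht : ((((P.d + 2) * P.L : ℕ) : ℝ) ^ 2 / 4) * a < deltaSU n)
    (havg : dist1 (avgFun (expMeanLogSU (n := n)) W ⟨iterBlockOf 1 x, μ⟩ * (avgFun (expMeanLogSU (n := n)) Y ⟨iterBlockOf 1 x, μ⟩)⁻¹) ≤ α₁) :
    dist1 (W ⟨x, μ⟩ * (Y ⟨x, μ⟩)⁻¹) ≤
      α₁ + 2 * (6 * (((((P.d + 2) * P.L : ℕ) : ℝ) ^ 2 / 4) * a)) +
        ((P.d * ((P.L - 1) / 2) : ℕ) : ℝ) * ((4 * ((P.d : ℝ) * (P.L : ℝ)) ^ 2 + 2) * a) := by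
  have hj : 0 + 1 ≤ P.m + P.K := hk
  set y : Site P 1 := iterBlockOf 1 x with hy
  have hcross' : blockOf (x.shift μ) ≠ blockOf x := hcross
  obtain ⟨v, hv, hvμ, hxv⟩ := exists_rel_of_cross hj hcross'
  have hyx : blockOf x = y := rfl
  rw [hyx] at hxv
  -- (A) the central link, three-block letters from the ball
  have h3 : ∀ z : Site P 0, (blockOf z = y.unshift μ ∨ blockOf z = y ∨ blockOf z = y.shift μ) → Site.tdist z (emb y) ≤ 2 * P.d * P.L + P.L :=
    fun z hz => (tdist_emb_le_of_three_blocks hk y μ z hz).trans (by nlinarith [P.hd, P.L_pos])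
  have hW3 : ∀ q : Plaq P 0, (blockOf q.src = y.unshift μ ∨ blockOf q.src = y ∨ blockOf q.src = y.shift μ) →
      dist1 (GaugeField.plaqHol W q) < a := fun q hq => hW q (h3 q.src hq)
  have hY3 : ∀ q : Plaq P 0, (blockOf q.src = y.unshift μ ∨ blockOf q.src = y ∨ blockOf q.src = y.shift μ) →
      dist1 (GaugeField.plaqHol Y q) < a := fun q hq => hY q (h3 q.src hq)
  have hax₀ : axialT W (emb y) (transl (emb y) ((((P.L - 1) / 2 : ℕ) : ℤ) • e μ)) =
      axialT Y (emb y) (transl (emb y) ((((P.L - 1) / 2 : ℕ) : ℤ) • e μ)) := by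
    have h := hax (transl (emb y) ((((P.L - 1) / 2 : ℕ) : ℤ) • e μ))
    have hb : iterBlockOf 1 (transl (emb y) ((((P.L - 1) / 2 : ℕ) : ℤ) • e μ)) = y := blockOf_axisPt hj y μ
    rwa [hb] at h
  have hax₁ : axialT W (emb (y.shift μ)) ((transl (emb y) ((((P.L - 1) / 2 : ℕ) : ℤ) • e μ)).shift μ) =
      axialT Y (emb (y.shift μ)) ((transl (emb y) ((((P.L - 1) / 2 : ℕ) : ℤ) • e μ)).shift μ) := by
    have h := hax ((transl (emb y) ((((P.L - 1) / 2 : ℕ) : ℤ) • e μ)).shift μ)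
    have hb : iterBlockOf 1 ((transl (emb y) ((((P.L - 1) / 2 : ℕ) : ℤ) • e μ)).shift μ) = y.shift μ := blockOf_axisPt_shift hj y μ
    rwa [hb] at h
  have hcentral := dist1_central_link_le_local hj ha W Y y μ hW3 hY3 ht hax₀ hax₁ havg
  -- (B) the sweep from the axis point to `x = emb y + v`, `n = d·h ≥ |v|₁ − h`
  have hl : l1 v ≤ (P.L - 1) / 2 + P.d * ((P.L - 1) / 2) := by
    have h1 : l1 v ≤ P.d * ((P.L - 1) / 2) := by
      unfold l1
      calc ∑ κ, (v κ).natAbs ≤ ∑ _κ : Fin P.d, (P.L - 1) / 2 := Finset.sum_le_sum fun κ _ => hv κ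
        _ = P.d * ((P.L - 1) / 2) := by rw [Finset.sum_const, Finset.card_univ, Fintype.card_fin, smul_eq_mul]
    omega
  have hsweep := dist1_cross_le_sweep_local hk W Y ha hax y μ hW hY (P.d * ((P.L - 1) / 2)) v hv hvμ hl
  rw [← hxv] at hsweep
  linarith

end Cross

end Summit.QuantumFields.YangMills.Theorems.FluctuationComparisonRegPrIntLS2BetaOneStepLocalCrossingBounds

end
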